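import Summits.ValiantsHypothesis.ValiantsHypothesis.Theses.NumTame

/-!
# ValiantsHypothesis / NumTame — item `EmbeddingChoice` (stmt-ValiantsHypothesis-5390), closed

Pigeonhole over the `[K:ℚ]` complex embeddings: if each of `κ_0,…,κ_{m-1} ∈ K` has
`Π_σ max(1,|σκ_j|) ≤ 2^{H[K:ℚ]}`, then `Π_σ Π_j max(1,|σκ_j|) ≤ 2^{mH[K:ℚ]}`, so some embedding `σ`
has `Π_j max(1,|σκ_j|) ≤ 2^{mH}` (there are exactly `[K:ℚ]` embeddings,
`NumberField.Embeddings.card`), whence every `|σκ_j| ≤ 2^{mH} ≤ 2^{mH+1}`. HONEST FRAMING: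
bookkeeping; nothing here is progress on `VP ≠ VNP`.
-/

-- layout Summits/ValiantsHypothesis/ValiantsHypothesis forces the duplicated namespace component
set_option linter.dupNamespace false

namespace Summit.ValiantsHypothesis.ValiantsHypothesis.Theorems.NumTame

/-- **Item `EmbeddingChoice` (stmt-ValiantsHypothesis-5390).** [folklore] -/
theorem embeddingChoice_proof : Theses.NumTame.EmbeddingChoice := by
  unfold Theses.NumTame.EmbeddingChoice
  intro K _ _ m H κ hκ
  by_contra hne
  push Not at hne
  -- every embedding has a large product
  have hbig : ∀ σ : K →+* ℂ, (2 : ℝ) ^ (m * H + 1) < ∏ j, max 1 ‖σ (κ j)‖ := by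
    intro σ
    obtain ⟨j, hj⟩ := hne σ
    calc (2 : ℝ) ^ (m * H + 1) < ‖σ (κ j)‖ := hj
      _ ≤ max 1 ‖σ (κ j)‖ := le_max_right _ _
      _ = ∏ j' : Fin m, (if j' = j then max 1 ‖σ (κ j)‖ else 1) := by
          rw [Finset.prod_ite_eq' Finset.univ j, if_pos (Finset.mem_univ j)]
      _ ≤ ∏ j', max 1 ‖σ (κ j')‖ := by
          refine Finset.prod_le_prod (fun j' _ => by split_ifs <;> positivity) (fun j' _ => ?_)
          split_ifs with h
          · rw [h]
          · exact le_max_left _ _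
  -- the total product is small …
  have hsmall : ∏ σ : K →+* ℂ, ∏ j, max 1 ‖σ (κ j)‖ ≤ (2 : ℝ) ^ (H * Module.finrank ℚ K * m) :=
    calc ∏ σ : K →+* ℂ, ∏ j, max 1 ‖σ (κ j)‖ = ∏ j, ∏ σ : K →+* ℂ, max 1 ‖σ (κ j)‖ :=
          Finset.prod_comm
      _ ≤ ∏ _j : Fin m, (2 : ℝ) ^ (H * Module.finrank ℚ K) :=
          Finset.prod_le_prod (fun j _ => Finset.prod_nonneg fun σ _ => by positivity) (fun j _ => hκ j)
      _ = (2 : ℝ) ^ (H * Module.finrank ℚ K * m) := by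
          rw [Finset.prod_const, Finset.card_univ, Fintype.card_fin, ← pow_mul]
  -- … and large
  have hcard : Fintype.card (K →+* ℂ) = Module.finrank ℚ K := NumberField.Embeddings.card K ℂ
  have hne' : (Finset.univ : Finset (K →+* ℂ)).Nonempty := by
    rw [← Finset.card_pos, Finset.card_univ, hcard]
    exact Module.finrank_pos
  have hlarge : (2 : ℝ) ^ ((m * H + 1) * Module.finrank ℚ K) < ∏ σ : K →+* ℂ, ∏ j, max 1 ‖σ (κ j)‖ :=
    calc (2 : ℝ) ^ ((m * H + 1) * Module.finrank ℚ K) = ∏ _σ : K →+* ℂ, (2 : ℝ) ^ (m * H + 1) := by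
          rw [Finset.prod_const, Finset.card_univ, hcard, ← pow_mul]
      _ < ∏ σ : K →+* ℂ, ∏ j, max 1 ‖σ (κ j)‖ :=
          Finset.prod_lt_prod_of_nonempty (fun σ _ => by positivity) (fun σ _ => hbig σ) hne'
  have hexp : (2 : ℝ) ^ (H * Module.finrank ℚ K * m) ≤ (2 : ℝ) ^ ((m * H + 1) * Module.finrank ℚ K) :=
    pow_le_pow_right₀ (by norm_num) (by nlinarith)
  linarith

end Summit.ValiantsHypothesis.ValiantsHypothesis.Theorems.NumTame
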